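import Literature.MathematicalPhysics.QuantumFieldTheory.BalabanImbrieJaffe1984to88.BIJ88Ineq312Instance
import Literature.MathematicalPhysics.QuantumFieldTheory.BalabanImbrieJaffe1984to88.BIJ88GaussFactor309

/-!
# `BalabanImbrieJaffe1984to88.BIJ88ObservableExtraction312` — T. Bałaban, J. Imbrie, A. Jaffe, *Effective action and cluster properties of the
abelian Higgs model*, Commun. Math. Phys. **114** (1988) 257–315 [BalabanImbrieJaffe1988]: Sect. 5.14, pp. 311–312 [PDF 55–56] — **THE OBSERVABLE
EXTRACTION** (row `C2.Claim@312`, *"observable extraction and |G_k(X)|"*) at the level print describes it: the p. 311 classification of the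
connected components produced by the integrations by parts (*complete* / *remainder* / *constant*), the termination sentence, the small factors a
remainder component carries, the p. 312 sentence *"By performing sufficiently many integrations by parts, we have arranged for enough small factors
to beat these large factors"* as ARITHMETIC with explicit thresholds, and — BY NAME from gen 12's `BIJ88Ineq312Instance.norm_Gk_le_printed` — r16's
leaf `Ineq312` in the PRINTED CURRENCY: the product of large factors `[c(L^kε)^{−m(c)}e^{−m′(c)}]` over the observables NEAR THE BOUNDARY only.

HONEST FRAMING (cell `lit-balaban`, verbatim): statement-level skeleton of published theorems with citation tags; proofs where landed; nothing here is a claim about the Yang–Mills mass gap.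

PDF held: `paper:balaban1988-cmp114-bij-abelian-higgs-effective-action` (journal page = PDF page + 256); pp. 311–312 = PDF 55–56, read this
session (`lit read … --pages 50-59`).

**The print (verbatim).** p. 311: *"We apply a somewhat different procedure to extract the proper perturbative terms from the observable. We
integrate by parts in the Gaussian expectation (5.14.1). Each F^{m̄}_{k,loc}(X_{σ₁}) is a polynomial in A^{(k)}, φ^{(k)}; those fields can be
contracted via covariances C^{(k)}_{ℤ^d,loc} or C^{(k)}_{loc}(u_{k+1}) to other observables, to χ′_{Λ₉^{(k)}}, or to the interaction. After each
integration by parts, we replace the covariance by C^{(k)}_{loc} or C^{(k)}_{loc}(u_{k+1}) and give a random walk expansion for the difference. For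
each term, let X be the union of the cubes covering the X_{σ₁} and the regions from the random walk expansion. A connected component of X is
called complete if a contraction to χ′_{Λ₉^{(k)}} occurs, if a term from the random walk expansion occurs, if at least m + 1 interactions have been
differentiated down, or if the term is constant (all legs contracted). We stop integrating by parts fields in complete components of X. After
sufficiently many integrations by parts, all components of X will be complete. We break up the observable according to the connected components
of X. The components containing contractions to χ′_{Λ₉^{(k)}}, terms from the random walk expansions, or at least m+1 interactions are called
remainder components {X_r}. The other components are called constant components {X_c}, since the observable there is independent of A^{(k)},
φ^{(k)}."* p. 312: *"The main source of concern in estimating G_k(X_{r′}) is that we only have bounds |F_{k,loc}(X_{σ₁})| ≤ c(L^kε)^{−m(c)}e^{−m′(c)},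
coming from our estimates on perturbation expansions of observables; similarly for F_{k+1,loc}(X_c). Here m(c), m′(c) depend on the terms in F
in X_{σ₁} or X_c. By performing sufficiently many integrations by parts, we have arranged for enough small factors to beat these large factors in
the remainder terms (at least if X_{r′} is not at the boundary of Λ₁₂^{(k)}). Near the boundary we have potentially large covariances
C^{(k)}_{ℤ^d,loc} − C^{(k)}_{ℤ^d} or C^{(k)}_{ℤ^d,loc}(u_{k+1}) − C^{(k)}_{loc}(u_{k+1}), so we make use of the proximity to Λ₁₂^{(k)c} to provide the
necessary convergence. These considerations lead to the following estimate: |G_k(X)| ≤ c(F(X)) (e^β(L^kε/ε₀)^{1/4−α})^{β′|X∖∪X_c|}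
Π_{X_{σ₁}⊂X: dist(X_{σ₁},Λ^{(k)c}_{12}) < r(e_k)} [c(L^kε)^{−m(c)}e^{−m′(c)}]."*

**What is proved (0 `sorry`, standard axioms, 0 new `Prop` facts).**
* §1 (p. 311, MODEL READING — the bookkeeping datum of one connected component of `X` during the integrations by parts: the numbers of
  contractions to `χ′`, of random-walk terms, of interactions differentiated down, of uncontracted legs): `IbpComponent`; the printed
  classification **`IsComplete`** (the four printed clauses), **`IsRemainder`**, **`IsConstant`** (defs with bodies); `isComplete_iff`,
  `isComplete_iff_isRemainder_or_isConstant`, `legs_eq_zero_of_isConstant` (*"all legs contracted"*), `not_isRemainder_of_isConstant`; the printed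
  IBP events as a step relation `Step D` (contraction to another observable / to `χ′` / to the interaction, which brings `≤ D` new legs / the
  random-walk remainder of the replaced covariance) and **`exists_isComplete_of_steps`**: *"After sufficiently many integrations by parts, all
  components of X will be complete"* — every run of steps taken in incomplete components reaches a complete component within
  `μ = (m+1−n_V)(D+1) + legs` steps (a strictly decreasing potential); `merge`/`isRemainder_merge`/`mu_merge_le` (components joined by a contraction).
* §2 (p. 312, the small factors of a remainder component): **`smallFactor`** `= θ_χ^{n_χ} θ_RW^{n_RW} θ_V^{n_V}` (the `χ′`-contraction factor
  `e^{−cp(e_k)²}` of p. 307/309, the random-walk factor `e^{−cr(e_k)}` of p. 311, the vertex factor `e^β(L^kε/ε₀)^{1/4−α}` of p. 298 per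
  interaction), `smallFactor_le_one`, **`smallFactor_le_of_isRemainder`** (`≤ max{θ_χ, θ_RW, θ_V^{m+1}}`).
* §3 (p. 312 *"enough small factors to beat these large factors"*, ARITHMETIC with explicit thresholds; large factor `C·(L^kε)^{−m_c}`, `C ≥ 0`
  standing for `c·e^{−m′(c)}`, a k-independent constant in either reading of the letter `e`, cf. GAPS G-C2-p36-04): **`vertex_pow_mul_large_le`**
  (vertex case: `θ_V = E·s^{1/4−α}`, `s = L^kε/ε₀ ∈ (0,1]`, IBP depth `(m+1)(1/4−α) ≥ m_c` ⟹ `θ_V^{m+1}·C(L^kε)^{−m_c} ≤ C·E^{m+1}·ε₀^{−m_c}`,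
  uniformly in k; `E = e^β`), `vertex_pow_mul_large_le_rpow` (with a margin `κ′` a factor `(L^kε/ε₀)^{κ′}` survives),
  `spacing_rpow_neg_le_eK_rpow_neg` (`(L^kε)^{−m_c} ≤ e_k^{−2m_c/(4−d)}`, e_k of (2.2), `0 < e ≤ 1`, `d < 4`), `eK_rpow_mul_le`,
  **`chi_mul_large_le`** (`χ′` case, by name from `BIJ88GaussFactor309.exp_pLog_sq_le_pow`: `e^{−cp(e_k)²}·C(L^kε)^{−m_c} ≤ C` once
  `2m_c/(4−d) ≤ n+1 ≤ c|log e_k⁻¹|^{2p−1}`), **`rw_mul_large_le`** (random-walk case, by name from `BIJ88ScaleSums.exp_rLen_le_rpow`: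
  `e^{−cr(e_k)}·C(L^kε)^{−m_c} ≤ C` once `2m_c/(4−d) ≤ c(log e_k⁻¹)^{r−1}`), **`smallFactor_mul_large_le`** (hence the small factor of EVERY
  remainder component beats the large factor when the three do).
* §4 (p. 312 estimate, gas level, BY NAME from `BIJ88Ineq312Instance.norm_Gk_le_printed` for the observable-carrying gas of (5.14.3), gens 11–12):
  **`norm_Gk_le_boundaryForm`** — observable activities carrying, per located observable `j`, its large factor `D_j ≥ 0` times its completeness
  small factor `σ_j ∈ [0,1]`, with `D_j σ_j ≤ B_j` for the observables NOT near the boundary (§3), give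
  `‖G_k(X′)‖ ≤ [e^{2a₀#T}·N_D(X′)·Π_{j∈obsIn X′, ¬bdry j} B_j] · θ^{β″·#(T∖slot cubes)} · Π_{j∈obsIn X′, bdry j} D_j` — the printed form, `c(F(X))`
  depending on the observables in `X` and the product over the observables near the boundary only; **`ineq312_boundaryForm`** (the same as an
  instance of the leaf `BIJ88Sect5StatementsPart4.Ineq312`); **`ineq312_printedCurrency`** (`σ_j = θ^{m_j+1}`, `D_j = C_j(L^kε)^{−m_j^c}`,
  `θ = E(L^kε/ε₀)^{1/4−α}`, thresholds `(m_j+1)(1/4−α) ≥ m_j^c` — the vertex case of §3 discharging the beat).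
HONEST SCOPE: (a) the integration-by-parts EXPANSION itself — that the remainder activities of (5.14.5) have the structure "Π(large factor ×
completeness small factor) × small factor per non-slot cube" — is print's *"Without going into details"* and is NOT modelled (it is the SHAPE of the
hypothesis `hobs`, as in gen 12); (b) the boundary mechanism (*"we make use of the proximity to Λ₁₂^{(k)c}"*, Sect. 5.15) is not modelled — near the
boundary only `σ_j ≤ 1` is used, exactly as the printed estimate keeps the large factors there; (c) constants generic. Imports `BIJ88Ineq312Instance`
(gen 12), `BIJ88GaussFactor309` (p36 g4); modifies nothing. NOT summit progress; NOT continuum; NOT Clay. Cell `lit-balaban` Phase 2, seat p25 gen 13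
(row owner r16, referee ref-5).
-/

noncomputable section

open Finset
open Literature.Probability.LatticeModels
open Literature.MathematicalPhysics.QuantumFieldTheory.BalabanImbrieJaffe1984to88.BIJ88VirtualSupports310
open Literature.MathematicalPhysics.QuantumFieldTheory.BalabanImbrieJaffe1984to88.BIJ88Expansion5143
open Literature.MathematicalPhysics.QuantumFieldTheory.BalabanImbrieJaffe1984to88.BIJ88Expansion5143Ordered
open Literature.MathematicalPhysics.QuantumFieldTheory.BalabanImbrieJaffe1984to88.BIJ88ObservableGas312
open Literature.MathematicalPhysics.QuantumFieldTheory.BalabanImbrieJaffe1984to88.BIJ88ClusterSupports312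
open Literature.MathematicalPhysics.QuantumFieldTheory.BalabanImbrieJaffe1984to88.BIJ88SupportRegrouping312
open Literature.MathematicalPhysics.QuantumFieldTheory.BalabanImbrieJaffe1984to88.BIJ88ObservableFactorization312
open Literature.MathematicalPhysics.QuantumFieldTheory.BalabanImbrieJaffe1984to88.BIJ88Expansion5143Obs
open Literature.MathematicalPhysics.QuantumFieldTheory.BalabanImbrieJaffe1984to88.BIJ88Expansion5143KP
open Literature.MathematicalPhysics.QuantumFieldTheory.BalabanImbrieJaffe1984to88.BIJ88Expansion5143GkBound
open Literature.MathematicalPhysics.QuantumFieldTheory.BalabanImbrieJaffe1984to88.BIJ88Ineq312Instance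
open Literature.MathematicalPhysics.QuantumFieldTheory.BalabanImbrieJaffe1984to88.BIJ88Ineq5113Covering (cubeSys)
open Literature.MathematicalPhysics.QuantumFieldTheory.BalabanImbrieJaffe1984to88.BIJ88Sect2Statements (eK rLen pLog)
open Literature.MathematicalPhysics.QuantumFieldTheory.BalabanImbrieJaffe1984to88.BIJ88ScaleSums (exp_rLen_le_rpow eK_pos)
open Literature.MathematicalPhysics.QuantumFieldTheory.BalabanImbrieJaffe1984to88.BIJ88GaussFactor309 (exp_pLog_sq_le_pow eK_le_one_of)

namespace Literature.MathematicalPhysics.QuantumFieldTheory.BalabanImbrieJaffe1984to88.BIJ88ObservableExtraction312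

/-! ## §1 p. 311: complete, remainder and constant components; termination of the integrations by parts -/

/-- p. 311 [PDF 55], MODEL READING of *"For each term, let X be the union of the cubes covering the X_{σ₁} and the regions from the random walk
expansion. A connected component of X is called complete if a contraction to χ′_{Λ₉^{(k)}} occurs, if a term from the random walk expansion
occurs, if at least m + 1 interactions have been differentiated down, or if the term is constant (all legs contracted)."* — the bookkeeping datum of
one connected component: how many contractions to `χ′`, random-walk terms and differentiated interactions it contains, and how many legs (fields of
its observables and differentiated interactions) are still uncontracted. [cite: BalabanImbrieJaffe1988, p.311 (Sect. 5.14)] -/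
structure IbpComponent where
  /-- the number of contractions to `χ′_{Λ₉^{(k)}}` in the component -/
  nChi : ℕ
  /-- the number of terms from the random walk expansions (covariance differences) in the component -/
  nRW : ℕ
  /-- the number of interactions differentiated down in the component -/
  nV : ℕ
  /-- the number of uncontracted legs in the component -/
  legs : ℕ

namespace IbpComponent

variable (m : ℕ)

/-- p. 311, verbatim: *"The components containing contractions to χ′_{Λ₉^{(k)}}, terms from the random walk expansions, or at least m+1
interactions are called remainder components {X_r}."* [cite: BalabanImbrieJaffe1988, p.311 (Sect. 5.14)] -/
def IsRemainder (κ : IbpComponent) : Prop := 0 < κ.nChi ∨ 0 < κ.nRW ∨ m + 1 ≤ κ.nV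

/-- p. 311, verbatim: *"A connected component of X is called complete if a contraction to χ′_{Λ₉^{(k)}} occurs, if a term from the random walk
expansion occurs, if at least m + 1 interactions have been differentiated down, or if the term is constant (all legs contracted)."* — the four
printed clauses. [cite: BalabanImbrieJaffe1988, p.311 (Sect. 5.14)] -/
def IsComplete (κ : IbpComponent) : Prop := 0 < κ.nChi ∨ 0 < κ.nRW ∨ m + 1 ≤ κ.nV ∨ κ.legs = 0

/-- p. 311, verbatim: *"The other components are called constant components {X_c}, since the observable there is independent of A^{(k)},
φ^{(k)}."* — complete and not a remainder component. [cite: BalabanImbrieJaffe1988, p.311 (Sect. 5.14)] -/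
def IsConstant (κ : IbpComponent) : Prop := IsComplete m κ ∧ ¬ IsRemainder m κ

/-- the classification is decidable (finite data). [cite: BalabanImbrieJaffe1988, p.311 (Sect. 5.14)] -/
instance instDecidableIsRemainder (κ : IbpComponent) : Decidable (IsRemainder m κ) := by unfold IsRemainder; infer_instance

/-- the classification is decidable (finite data). [cite: BalabanImbrieJaffe1988, p.311 (Sect. 5.14)] -/
instance instDecidableIsComplete (κ : IbpComponent) : Decidable (IsComplete m κ) := by unfold IsComplete; infer_instance

/-- the classification is decidable (finite data). [cite: BalabanImbrieJaffe1988, p.311 (Sect. 5.14)] -/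
instance instDecidableIsConstant (κ : IbpComponent) : Decidable (IsConstant m κ) := by unfold IsConstant; infer_instance

variable {m}

/-- complete = remainder, or all legs contracted. [cite: BalabanImbrieJaffe1988, p.311 (Sect. 5.14)] -/
theorem isComplete_iff (κ : IbpComponent) : IsComplete m κ ↔ IsRemainder m κ ∨ κ.legs = 0 := by
  simp only [IsComplete, IsRemainder, or_assoc]

/-- a remainder component is complete (*"We stop integrating by parts fields in complete components"*). [cite: BalabanImbrieJaffe1988, p.311 (Sect. 5.14)] -/
theorem IsRemainder.isComplete {κ : IbpComponent} (h : IsRemainder m κ) : IsComplete m κ := (isComplete_iff κ).2 (Or.inl h)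

/-- *"We break up the observable according to the connected components of X"*: a complete component is a remainder component or a constant
component, and not both. [cite: BalabanImbrieJaffe1988, p.311 (Sect. 5.14)] -/
theorem isComplete_iff_isRemainder_or_isConstant (κ : IbpComponent) : IsComplete m κ ↔ IsRemainder m κ ∨ IsConstant m κ := by
  by_cases h : IsRemainder m κ
  · exact ⟨fun _ => Or.inl h, fun _ => h.isComplete⟩
  · exact ⟨fun hc => Or.inr ⟨hc, h⟩, fun h' => h'.elim IsRemainder.isComplete And.left⟩

/-- the two classes are disjoint. [cite: BalabanImbrieJaffe1988, p.311 (Sect. 5.14)] -/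
theorem not_isRemainder_of_isConstant {κ : IbpComponent} (h : IsConstant m κ) : ¬ IsRemainder m κ := h.2

/-- *"or if the term is constant (all legs contracted)"*: in a constant component all legs are contracted (so the observable there no longer
depends on the fields). [cite: BalabanImbrieJaffe1988, p.311 (Sect. 5.14)] -/
theorem legs_eq_zero_of_isConstant {κ : IbpComponent} (h : IsConstant m κ) : κ.legs = 0 :=
  ((isComplete_iff κ).1 h.1).resolve_left h.2

/-- conversely a component with all legs contracted and fewer than the stated events is constant. [cite: BalabanImbrieJaffe1988, p.311 (Sect. 5.14)] -/
theorem isConstant_of_legs_eq_zero {κ : IbpComponent} (h0 : κ.legs = 0) (h : ¬ IsRemainder m κ) : IsConstant m κ :=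
  ⟨(isComplete_iff κ).2 (Or.inr h0), h⟩

/-- p. 311, MODEL READING of the integration-by-parts events (*"those fields can be contracted via covariances … to other observables, to
χ′_{Λ₉^{(k)}}, or to the interaction. After each integration by parts, we replace the covariance by C^{(k)}_{loc} … and give a random walk expansion
for the difference"*): one event changes the datum of the component by — a contraction of a leg to a leg of another observable (two legs
consumed); a contraction to `χ′` (one leg consumed); a contraction to the interaction, which differentiates one interaction down and brings at most
`D` new legs (the degree of the interaction polynomial); the random-walk remainder of the replaced covariance. [cite: BalabanImbrieJaffe1988, p.311 (Sect. 5.14)] -/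
inductive Step (D : ℕ) : IbpComponent → IbpComponent → Prop
  | toObs {κ : IbpComponent} (h : 2 ≤ κ.legs) : Step D κ { κ with legs := κ.legs - 2 }
  | toChi {κ : IbpComponent} (h : 1 ≤ κ.legs) : Step D κ { κ with nChi := κ.nChi + 1, legs := κ.legs - 1 }
  | toV {κ : IbpComponent} (a : ℕ) (ha : a ≤ D) (h : 1 ≤ κ.legs) : Step D κ { κ with nV := κ.nV + 1, legs := κ.legs - 1 + a }
  | rw {κ : IbpComponent} : Step D κ { κ with nRW := κ.nRW + 1 }

/-- the termination potential: `μ = (m + 1 − n_V)(D + 1) + legs` (truncated subtraction). [cite: BalabanImbrieJaffe1988, p.311 (Sect. 5.14)] -/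
def mu (m D : ℕ) (κ : IbpComponent) : ℕ := (m + 1 - κ.nV) * (D + 1) + κ.legs

/-- an incomplete component has positive potential. [cite: BalabanImbrieJaffe1988, p.311 (Sect. 5.14)] -/
theorem mu_pos_of_not_isComplete {D : ℕ} {κ : IbpComponent} (h : ¬ IsComplete m κ) : 0 < mu m D κ := by
  have hV : κ.nV ≤ m := by
    by_contra h'
    exact h ((isComplete_iff κ).2 (Or.inl (Or.inr (Or.inr (by omega)))))
  unfold mu
  have : 1 ≤ m + 1 - κ.nV := by omega
  nlinarith

/-- **each event taken in an INCOMPLETE component either completes it or strictly lowers the potential.**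
[cite: BalabanImbrieJaffe1988, p.311 (Sect. 5.14)] -/
theorem isComplete_or_mu_lt_of_step {D : ℕ} {κ κ' : IbpComponent} (hs : Step D κ κ') (h : ¬ IsComplete m κ) :
    IsComplete m κ' ∨ mu m D κ' < mu m D κ := by
  have hV : κ.nV ≤ m := by
    by_contra h'
    exact h ((isComplete_iff κ).2 (Or.inl (Or.inr (Or.inr (by omega)))))
  cases hs with
  | toObs hl =>
      right
      simp only [mu]
      omega
  | toChi hl =>
      left
      exact (isComplete_iff _).2 (Or.inl (Or.inl (Nat.succ_pos _)))
  | toV a ha hl =>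
      right
      simp only [mu]
      have h1 : m + 1 - (κ.nV + 1) + 1 = m + 1 - κ.nV := by omega
      have h2 : (m + 1 - κ.nV) * (D + 1) = (m + 1 - (κ.nV + 1)) * (D + 1) + (D + 1) := by
        rw [← h1]; ring
      rw [h2]
      omega
  | rw =>
      left
      exact (isComplete_iff _).2 (Or.inl (Or.inr (Or.inl (Nat.succ_pos _))))

/-- **p. 311, verbatim: *"We stop integrating by parts fields in complete components of X. After sufficiently many integrations by parts, all
components of X will be complete."*** — PROVED for the step relation: along any run of events taken in incomplete components, a complete component
is reached after at most `μ = (m + 1 − n_V)(D + 1) + legs` events (counted from the initial datum). [cite: BalabanImbrieJaffe1988, p.311 (Sect. 5.14)] -/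
theorem exists_isComplete_of_steps {D : ℕ} (f : ℕ → IbpComponent) (hf : ∀ i, ¬ IsComplete m (f i) → Step D (f i) (f (i + 1))) :
    ∃ i ≤ mu m D (f 0), IsComplete m (f i) := by
  suffices H : ∀ n (g : ℕ → IbpComponent), (∀ i, ¬ IsComplete m (g i) → Step D (g i) (g (i + 1))) → mu m D (g 0) ≤ n →
      ∃ i ≤ n, IsComplete m (g i) from
    (H _ f hf le_rfl)
  intro n
  induction n with
  | zero =>
      intro g hg h0
      by_cases hc : IsComplete m (g 0)
      · exact ⟨0, le_rfl, hc⟩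
      · exact absurd h0 (not_le.2 (mu_pos_of_not_isComplete hc))
  | succ n ih =>
      intro g hg hn
      by_cases hc : IsComplete m (g 0)
      · exact ⟨0, Nat.zero_le _, hc⟩
      · rcases isComplete_or_mu_lt_of_step (hg 0 hc) hc with h1 | hlt
        · exact ⟨1, by omega, h1⟩
        · obtain ⟨i, hi, hci⟩ := ih (fun j => g (j + 1)) (fun j hj => hg (j + 1) hj) (by omega)
          exact ⟨i + 1, by omega, hci⟩

/-- two components joined by a contraction across them (*"contracted … to other observables"*): the data add. [cite: BalabanImbrieJaffe1988, p.311 (Sect. 5.14)] -/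
def merge (κ₁ κ₂ : IbpComponent) : IbpComponent :=
  ⟨κ₁.nChi + κ₂.nChi, κ₁.nRW + κ₂.nRW, κ₁.nV + κ₂.nV, κ₁.legs + κ₂.legs⟩

/-- a remainder component stays a remainder component when another component is joined to it. [cite: BalabanImbrieJaffe1988, p.311 (Sect. 5.14)] -/
theorem isRemainder_merge {κ₁ : IbpComponent} (h : IsRemainder m κ₁) (κ₂ : IbpComponent) : IsRemainder m (merge κ₁ κ₂) := by
  simp only [IsRemainder, merge] at h ⊢
  omega

/-- the potential is subadditive under joining (so the total potential of all components bounds the total number of events as well).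
[cite: BalabanImbrieJaffe1988, p.311 (Sect. 5.14)] -/
theorem mu_merge_le (D : ℕ) (κ₁ κ₂ : IbpComponent) : mu m D (merge κ₁ κ₂) ≤ mu m D κ₁ + mu m D κ₂ := by
  simp only [mu, merge]
  have : (m + 1 - (κ₁.nV + κ₂.nV)) * (D + 1) ≤ (m + 1 - κ₁.nV) * (D + 1) := Nat.mul_le_mul_right _ (by omega)
  omega

end IbpComponent

/-! ## §2 p. 312: the small factors carried by a remainder component -/

namespace IbpComponent

/-- The product of small factors a component has collected: one `θ_χ` per contraction to `χ′` (p. 307/309: *"factors e^{−cp(e_k)²} after integrating"*),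
one `θ_RW` per random-walk term (p. 311: *"These terms are bounded by … e^{−cr(e_k)}"*-type covariance differences), one vertex factor `θ_V`
per interaction differentiated down (p. 298: *"each vertex results in at least a factor e^β(L^kε/ε₀)^{1/4−α}"*). [cite: BalabanImbrieJaffe1988, p.312 (Sect. 5.14)] -/
def smallFactor (θχ θRW θV : ℝ) (κ : IbpComponent) : ℝ := θχ ^ κ.nChi * θRW ^ κ.nRW * θV ^ κ.nV

variable {θχ θRW θV : ℝ}

/-- the small factor is non-negative. [cite: BalabanImbrieJaffe1988, p.312 (Sect. 5.14)] -/
theorem smallFactor_nonneg (h1 : 0 ≤ θχ) (h2 : 0 ≤ θRW) (h3 : 0 ≤ θV) (κ : IbpComponent) : 0 ≤ smallFactor θχ θRW θV κ := by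
  unfold smallFactor; positivity

/-- the small factor is at most one (used as such near the boundary: *"at least if X_{r′} is not at the boundary of Λ₁₂^{(k)}"*).
[cite: BalabanImbrieJaffe1988, p.312 (Sect. 5.14)] -/
theorem smallFactor_le_one (h1 : 0 ≤ θχ) (h1' : θχ ≤ 1) (h2 : 0 ≤ θRW) (h2' : θRW ≤ 1) (h3 : 0 ≤ θV) (h3' : θV ≤ 1)
    (κ : IbpComponent) : smallFactor θχ θRW θV κ ≤ 1 := by
  unfold smallFactor
  calc θχ ^ κ.nChi * θRW ^ κ.nRW * θV ^ κ.nV ≤ 1 * 1 * 1 := by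
        gcongr
        · exact pow_le_one₀ h1 h1'
        · exact pow_le_one₀ h2 h2'
        · exact pow_le_one₀ h3 h3'
    _ = 1 := by ring

/-- **a remainder component carries at least one of the three small factors**: `θ_χ`, `θ_RW` or `θ_V^{m+1}` (all factors in `[0,1]`).
[cite: BalabanImbrieJaffe1988, p.312 (Sect. 5.14)] -/
theorem smallFactor_le_of_isRemainder {m : ℕ} (h1 : 0 ≤ θχ) (h1' : θχ ≤ 1) (h2 : 0 ≤ θRW) (h2' : θRW ≤ 1) (h3 : 0 ≤ θV) (h3' : θV ≤ 1)
    {κ : IbpComponent} (h : IsRemainder m κ) : smallFactor θχ θRW θV κ ≤ max θχ (max θRW (θV ^ (m + 1))) := by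
  unfold smallFactor
  have hχ1 : θχ ^ κ.nChi ≤ 1 := pow_le_one₀ h1 h1'
  have hR1 : θRW ^ κ.nRW ≤ 1 := pow_le_one₀ h2 h2'
  have hV1 : θV ^ κ.nV ≤ 1 := pow_le_one₀ h3 h3'
  rcases h with hχ | hR | hV
  · calc θχ ^ κ.nChi * θRW ^ κ.nRW * θV ^ κ.nV ≤ θχ ^ κ.nChi * 1 * 1 := by gcongr
      _ = θχ ^ κ.nChi := by ring
      _ ≤ θχ ^ 1 := pow_le_pow_of_le_one h1 h1' hχ
      _ ≤ max θχ (max θRW (θV ^ (m + 1))) := by rw [pow_one]; exact le_max_left _ _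
  · calc θχ ^ κ.nChi * θRW ^ κ.nRW * θV ^ κ.nV ≤ 1 * θRW ^ κ.nRW * 1 := by gcongr
      _ = θRW ^ κ.nRW := by ring
      _ ≤ θRW ^ 1 := pow_le_pow_of_le_one h2 h2' hR
      _ ≤ max θχ (max θRW (θV ^ (m + 1))) := by rw [pow_one]; exact le_trans (le_max_left _ _) (le_max_right _ _)
  · calc θχ ^ κ.nChi * θRW ^ κ.nRW * θV ^ κ.nV ≤ 1 * 1 * θV ^ κ.nV := by gcongr
      _ = θV ^ κ.nV := by ring
      _ ≤ θV ^ (m + 1) := pow_le_pow_of_le_one h3 h3' hV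
      _ ≤ max θχ (max θRW (θV ^ (m + 1))) := le_trans (le_max_right _ _) (le_max_right _ _)

end IbpComponent

/-! ## §3 p. 312: *"we have arranged for enough small factors to beat these large factors"* — arithmetic with explicit thresholds

The large factor of an observable is `c(L^kε)^{−m(c)}e^{−m′(c)}` (p. 312); we write it `C·(L^kε)^{−m_c}` with `C ≥ 0` standing for
`c·e^{−m′(c)}` — a k-independent constant in either reading of the letter `e` (Euler's number, or the charge as in GAPS G-C2-p36-04). -/

section Beat

/-- **VERTEX CASE** (*"at least m + 1 interactions have been differentiated down"*, each giving the vertex factor of p. 298): with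
`θ_V = E·s^{1/4−α}`, `s = L^kε/ε₀ ∈ (0, 1]` (`E = e^β`, `E ≥ 0`), the large factor `C·(L^kε)^{−m_c} = C·(sε₀)^{−m_c}` (`C ≥ 0`) and an
integration-by-parts depth `m` with `(m + 1)(1/4 − α) ≥ m_c`:
`θ_V^{m+1} · C(sε₀)^{−m_c} ≤ C · E^{m+1} · ε₀^{−m_c}` — a bound UNIFORM IN k (absorbed in print's `c(F(X))`).
[cite: BalabanImbrieJaffe1988, p.312 (Sect. 5.14)] -/
theorem vertex_pow_mul_large_le {E s ε₀ α C mc : ℝ} {m : ℕ} (hE : 0 ≤ E) (hs0 : 0 < s) (hs1 : s ≤ 1) (hε₀ : 0 < ε₀) (hC : 0 ≤ C)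
    (hdepth : mc ≤ ((m : ℝ) + 1) * (1 / 4 - α)) :
    (E * s ^ (1 / 4 - α)) ^ (m + 1) * (C * (s * ε₀) ^ (-mc)) ≤ C * E ^ (m + 1) * ε₀ ^ (-mc) := by
  have h1 : (E * s ^ (1 / 4 - α)) ^ (m + 1) = E ^ (m + 1) * s ^ ((1 / 4 - α) * ((m : ℝ) + 1)) := by
    rw [mul_pow, ← Real.rpow_natCast (s ^ (1 / 4 - α)) (m + 1), ← Real.rpow_mul hs0.le]
    push_cast
    ring_nf
  have h2 : (s * ε₀) ^ (-mc) = s ^ (-mc) * ε₀ ^ (-mc) := Real.mul_rpow hs0.le hε₀.le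
  have h3 : s ^ ((1 / 4 - α) * ((m : ℝ) + 1)) * s ^ (-mc) = s ^ ((1 / 4 - α) * ((m : ℝ) + 1) - mc) := by
    rw [← Real.rpow_add hs0]; ring_nf
  have hq : 0 ≤ (1 / 4 - α) * ((m : ℝ) + 1) - mc := by rw [mul_comm]; linarith
  have h4 : s ^ ((1 / 4 - α) * ((m : ℝ) + 1) - mc) ≤ 1 := Real.rpow_le_one hs0.le hs1 hq
  have hK : 0 ≤ C * E ^ (m + 1) * ε₀ ^ (-mc) := mul_nonneg (mul_nonneg hC (pow_nonneg hE _)) (Real.rpow_nonneg hε₀.le _)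
  calc (E * s ^ (1 / 4 - α)) ^ (m + 1) * (C * (s * ε₀) ^ (-mc))
      = E ^ (m + 1) * s ^ ((1 / 4 - α) * ((m : ℝ) + 1)) * (C * (s ^ (-mc) * ε₀ ^ (-mc))) := by rw [h1, h2]
    _ = C * E ^ (m + 1) * ε₀ ^ (-mc) * (s ^ ((1 / 4 - α) * ((m : ℝ) + 1)) * s ^ (-mc)) := by ring
    _ = C * E ^ (m + 1) * ε₀ ^ (-mc) * s ^ ((1 / 4 - α) * ((m : ℝ) + 1) - mc) := by rw [h3]
    _ ≤ C * E ^ (m + 1) * ε₀ ^ (-mc) * 1 := mul_le_mul_of_nonneg_left h4 hK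
    _ = C * E ^ (m + 1) * ε₀ ^ (-mc) := mul_one _

/-- the same with an EXTRA margin `κ′ ≥ 0` in the depth, `(m + 1)(1/4 − α) ≥ m_c + κ′`: a small factor `s^{κ′} = (L^kε/ε₀)^{κ′}` survives
(*"sufficiently many integrations by parts"*). [cite: BalabanImbrieJaffe1988, p.312 (Sect. 5.14)] -/
theorem vertex_pow_mul_large_le_rpow {E s ε₀ α C mc κ' : ℝ} {m : ℕ} (hE : 0 ≤ E) (hs0 : 0 < s) (hs1 : s ≤ 1) (hε₀ : 0 < ε₀) (hC : 0 ≤ C)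
    (hdepth : mc + κ' ≤ ((m : ℝ) + 1) * (1 / 4 - α)) :
    (E * s ^ (1 / 4 - α)) ^ (m + 1) * (C * (s * ε₀) ^ (-mc)) ≤ C * E ^ (m + 1) * ε₀ ^ (-mc) * s ^ κ' := by
  have h1 : (E * s ^ (1 / 4 - α)) ^ (m + 1) = E ^ (m + 1) * s ^ ((1 / 4 - α) * ((m : ℝ) + 1)) := by
    rw [mul_pow, ← Real.rpow_natCast (s ^ (1 / 4 - α)) (m + 1), ← Real.rpow_mul hs0.le]
    push_cast
    ring_nf
  have h2 : (s * ε₀) ^ (-mc) = s ^ (-mc) * ε₀ ^ (-mc) := Real.mul_rpow hs0.le hε₀.le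
  have h3 : s ^ ((1 / 4 - α) * ((m : ℝ) + 1)) * s ^ (-mc) = s ^ ((1 / 4 - α) * ((m : ℝ) + 1) - mc - κ') * s ^ κ' := by
    rw [← Real.rpow_add hs0, ← Real.rpow_add hs0]; ring_nf
  have hq : 0 ≤ (1 / 4 - α) * ((m : ℝ) + 1) - mc - κ' := by rw [mul_comm]; linarith
  have h4 : s ^ ((1 / 4 - α) * ((m : ℝ) + 1) - mc - κ') ≤ 1 := Real.rpow_le_one hs0.le hs1 hq
  have hK : 0 ≤ C * E ^ (m + 1) * ε₀ ^ (-mc) * s ^ κ' :=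
    mul_nonneg (mul_nonneg (mul_nonneg hC (pow_nonneg hE _)) (Real.rpow_nonneg hε₀.le _)) (Real.rpow_nonneg hs0.le _)
  calc (E * s ^ (1 / 4 - α)) ^ (m + 1) * (C * (s * ε₀) ^ (-mc))
      = E ^ (m + 1) * s ^ ((1 / 4 - α) * ((m : ℝ) + 1)) * (C * (s ^ (-mc) * ε₀ ^ (-mc))) := by rw [h1, h2]
    _ = C * E ^ (m + 1) * ε₀ ^ (-mc) * (s ^ ((1 / 4 - α) * ((m : ℝ) + 1)) * s ^ (-mc)) := by ring
    _ = (C * E ^ (m + 1) * ε₀ ^ (-mc) * s ^ κ') * s ^ ((1 / 4 - α) * ((m : ℝ) + 1) - mc - κ') := by rw [h3]; ring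
    _ ≤ (C * E ^ (m + 1) * ε₀ ^ (-mc) * s ^ κ') * 1 := mul_le_mul_of_nonneg_left h4 hK
    _ = C * E ^ (m + 1) * ε₀ ^ (-mc) * s ^ κ' := mul_one _

/-- **the large factor in the currency of the running charge**: with `e_k = (L^kε)^{(4−d)/2}e` ((2.2), r18's `BIJ88Sect2Statements.eK`),
`0 < e ≤ 1`, `d < 4`, `m_c ≥ 0`: `(L^kε)^{−m_c} ≤ e_k^{−2m_c/(4−d)}`. [cite: BalabanImbrieJaffe1988, (2.2) p.260] -/
theorem spacing_rpow_neg_le_eK_rpow_neg {L ε e mc : ℝ} {d k : ℕ} (hL : 0 < L) (hε : 0 < ε) (he0 : 0 < e) (he1 : e ≤ 1) (hd : d < 4)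
    (hmc : 0 ≤ mc) : (L ^ k * ε) ^ (-mc) ≤ eK L ε e d k ^ (-(mc / ((4 - (d : ℝ)) / 2))) := by
  have hx : 0 < L ^ k * ε := by positivity
  have hd' : (d : ℝ) < 4 := by exact_mod_cast hd
  have ha : 0 < (4 - (d : ℝ)) / 2 := by linarith
  have hM : 0 ≤ mc / ((4 - (d : ℝ)) / 2) := div_nonneg hmc ha.le
  unfold eK
  rw [Real.mul_rpow (Real.rpow_nonneg hx.le _) he0.le, ← Real.rpow_mul hx.le]
  have hne : (4 - (d : ℝ)) ≠ 0 := by linarith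
  have h1 : (4 - (d : ℝ)) / 2 * -(mc / ((4 - (d : ℝ)) / 2)) = -mc := by field_simp
  rw [h1]
  have h2 : 1 ≤ e ^ (-(mc / ((4 - (d : ℝ)) / 2))) := Real.one_le_rpow_of_pos_of_le_one_of_nonpos he0 he1 (by linarith)
  calc (L ^ k * ε) ^ (-mc) = (L ^ k * ε) ^ (-mc) * 1 := (mul_one _).symm
    _ ≤ (L ^ k * ε) ^ (-mc) * e ^ (-(mc / ((4 - (d : ℝ)) / 2))) := mul_le_mul_of_nonneg_left h2 (Real.rpow_nonneg hx.le _)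

/-- a power of the running charge beats a (lower) inverse power: `e_k^N · (C·e_k^{−M}) ≤ C` for `0 < e_k ≤ 1`, `M ≤ N`, `C ≥ 0`.
[cite: BalabanImbrieJaffe1988, p.312 (Sect. 5.14)] -/
theorem eK_rpow_mul_le {ek N M C : ℝ} (hek : 0 < ek) (hek1 : ek ≤ 1) (hC : 0 ≤ C) (hNM : M ≤ N) :
    ek ^ N * (C * ek ^ (-M)) ≤ C := by
  have h : ek ^ N * ek ^ (-M) = ek ^ (N - M) := by rw [← Real.rpow_add hek]; ring_nf
  calc ek ^ N * (C * ek ^ (-M)) = C * (ek ^ N * ek ^ (-M)) := by ring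
    _ = C * ek ^ (N - M) := by rw [h]
    _ ≤ C * 1 := mul_le_mul_of_nonneg_left (Real.rpow_le_one hek.le hek1 (by linarith)) hC
    _ = C := mul_one _

/-- **`χ′` CASE** (*"if a contraction to χ′_{Λ₉^{(k)}} occurs"*; the factor `e^{−cp(e_k)²}` of pp. 307/309, BY NAME from
`BIJ88GaussFactor309.exp_pLog_sq_le_pow`): in the e_k-small regime `n + 1 ≤ c|log e_k⁻¹|^{2p−1}` (`p > ½`, `c ≥ 0`) with
`2m_c/(4−d) ≤ n + 1`, and `L^kε ≤ 1`, `0 < e ≤ 1`, `d < 4`: `e^{−cp(e_k)²} · C(L^kε)^{−m_c} ≤ C`. [cite: BalabanImbrieJaffe1988, p.312 (Sect. 5.14)] -/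
theorem chi_mul_large_le {L ε e c p C mc : ℝ} {d k n : ℕ} (hL : 0 < L) (hε : 0 < ε) (he0 : 0 < e) (he1 : e ≤ 1) (hd : d < 4)
    (hLε1 : L ^ k * ε ≤ 1) (hp : 1 / 2 < p) (hc : 0 ≤ c) (hC : 0 ≤ C) (hmc : 0 ≤ mc)
    (hreg : (n : ℝ) + 1 ≤ c * Real.log (eK L ε e d k)⁻¹ ^ (2 * p - 1)) (hdepth : mc / ((4 - (d : ℝ)) / 2) ≤ (n : ℝ) + 1) :
    Real.exp (-(c * pLog p (eK L ε e d k) ^ 2)) * (C * (L ^ k * ε) ^ (-mc)) ≤ C := by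
  set ek := eK L ε e d k with hek_def
  have hek : 0 < ek := eK_pos hL hε he0 k
  have hek1 : ek ≤ 1 := eK_le_one_of (by positivity) hLε1 he0.le he1 hd
  have h1 : Real.exp (-(c * pLog p ek ^ 2)) ≤ ek ^ (n + 1) := exp_pLog_sq_le_pow hek le_rfl hek1 hp hc hreg
  have h1' : Real.exp (-(c * pLog p ek ^ 2)) ≤ ek ^ ((n : ℝ) + 1) := by
    have : (ek ^ (n + 1) : ℝ) = ek ^ ((n : ℝ) + 1) := by norm_cast
    rwa [this] at h1
  have h2 : (L ^ k * ε) ^ (-mc) ≤ ek ^ (-(mc / ((4 - (d : ℝ)) / 2))) := spacing_rpow_neg_le_eK_rpow_neg hL hε he0 he1 hd hmc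
  calc Real.exp (-(c * pLog p ek ^ 2)) * (C * (L ^ k * ε) ^ (-mc))
      ≤ ek ^ ((n : ℝ) + 1) * (C * ek ^ (-(mc / ((4 - (d : ℝ)) / 2)))) :=
        mul_le_mul h1' (mul_le_mul_of_nonneg_left h2 hC) (mul_nonneg hC (Real.rpow_nonneg (by positivity) _))
          (Real.rpow_nonneg hek.le _)
    _ ≤ C := eK_rpow_mul_le hek hek1 hC hdepth

/-- **RANDOM-WALK CASE** (*"if a term from the random walk expansion occurs"*; such terms are `O(e^{−cr(e_k)})`, p. 311, BY NAME from
`BIJ88ScaleSums.exp_rLen_le_rpow`): in the regime `2m_c/(4−d) ≤ c(log e_k⁻¹)^{r−1}` (`r > 1` as in (2.3)), with `L^kε ≤ 1`, `0 < e ≤ 1`,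
`d < 4`: `e^{−cr(e_k)} · C(L^kε)^{−m_c} ≤ C`. [cite: BalabanImbrieJaffe1988, p.312 (Sect. 5.14)] -/
theorem rw_mul_large_le {L ε e c r C mc : ℝ} {d k : ℕ} (hL : 0 < L) (hε : 0 < ε) (he0 : 0 < e) (he1 : e ≤ 1) (hd : d < 4)
    (hLε1 : L ^ k * ε ≤ 1) (hr : 1 < r) (hC : 0 ≤ C) (hmc : 0 ≤ mc)
    (hreg : mc / ((4 - (d : ℝ)) / 2) ≤ c * Real.log (eK L ε e d k)⁻¹ ^ (r - 1)) :
    Real.exp (-(c * rLen r (eK L ε e d k))) * (C * (L ^ k * ε) ^ (-mc)) ≤ C := by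
  set ek := eK L ε e d k with hek_def
  have hek : 0 < ek := eK_pos hL hε he0 k
  have hek1 : ek ≤ 1 := eK_le_one_of (by positivity) hLε1 he0.le he1 hd
  have h1 : Real.exp (-(c * rLen r ek)) ≤ ek ^ (mc / ((4 - (d : ℝ)) / 2)) := exp_rLen_le_rpow hek hek1 hr hreg
  have h2 : (L ^ k * ε) ^ (-mc) ≤ ek ^ (-(mc / ((4 - (d : ℝ)) / 2))) := spacing_rpow_neg_le_eK_rpow_neg hL hε he0 he1 hd hmc
  calc Real.exp (-(c * rLen r ek)) * (C * (L ^ k * ε) ^ (-mc))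
      ≤ ek ^ (mc / ((4 - (d : ℝ)) / 2)) * (C * ek ^ (-(mc / ((4 - (d : ℝ)) / 2)))) :=
        mul_le_mul h1 (mul_le_mul_of_nonneg_left h2 hC) (mul_nonneg hC (Real.rpow_nonneg (by positivity) _))
          (Real.rpow_nonneg hek.le _)
    _ ≤ C := eK_rpow_mul_le hek hek1 hC le_rfl

/-- **a remainder component NOT at the boundary beats its large factor**: if each of the three small factors beats `Λ = C(L^kε)^{−m_c}` (the
three cases above, bound `B`) then so does the small factor of every remainder component (`smallFactor_le_of_isRemainder`).
[cite: BalabanImbrieJaffe1988, p.312 (Sect. 5.14)] -/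
theorem smallFactor_mul_large_le {θχ θRW θV Λ B : ℝ} {m : ℕ} {κ : IbpComponent} (h1 : 0 ≤ θχ) (h1' : θχ ≤ 1) (h2 : 0 ≤ θRW)
    (h2' : θRW ≤ 1) (h3 : 0 ≤ θV) (h3' : θV ≤ 1) (hΛ : 0 ≤ Λ) (hκ : IbpComponent.IsRemainder m κ)
    (hbχ : θχ * Λ ≤ B) (hbRW : θRW * Λ ≤ B) (hbV : θV ^ (m + 1) * Λ ≤ B) :
    IbpComponent.smallFactor θχ θRW θV κ * Λ ≤ B := by
  have h := IbpComponent.smallFactor_le_of_isRemainder h1 h1' h2 h2' h3 h3' hκ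
  have hmax : max θχ (max θRW (θV ^ (m + 1))) * Λ ≤ B := by
    rcases max_cases θχ (max θRW (θV ^ (m + 1))) with ⟨hm, -⟩ | ⟨hm, -⟩
    · rw [hm]; exact hbχ
    · rw [hm]
      rcases max_cases θRW (θV ^ (m + 1)) with ⟨hm', -⟩ | ⟨hm', -⟩
      · rw [hm']; exact hbRW
      · rw [hm']; exact hbV
  exact (mul_le_mul_of_nonneg_right h hΛ).trans hmax

end Beat

/-! ## §4 p. 312: the `|G_k(X)|` estimate in the printed currency — large factors only for the observables near the boundary -/

section Main

variable {ι : Type*} [DecidableEq ι] [Fintype ι] {S : Type*} [DecidableEq S] {adj : ι → ι → Prop} [DecidableRel adj] {nbr : ι → Finset ι}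
  {Δ : ℕ} {W : Finset ι} {loc : S → ι} {K : Finset S}

/-- **`|G_k(X)| ≤ c(F(X)) · θ^{β″|X∖∪X_c|} · Π_{X_{σ₁}⊂X: dist(X_{σ₁},Λ₁₂^{(k)c}) < r(e_k)} [c(L^kε)^{−m(c)}e^{−m′(c)}]` AT GAS LEVEL** (gen 12's
`BIJ88Ineq312Instance.norm_Gk_le_printed` for the observable-carrying gas of (5.14.3), BY NAME): observable activities carrying, per located
observable `j ∈ H(X)`, its LARGE factor `D_j ≥ 0` (p. 312: *"we only have bounds |F_{k,loc}(X_{σ₁})| ≤ c(L^kε)^{−m(c)}e^{−m′(c)}"*) times its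
completeness SMALL factor `σ_j ∈ [0, 1]` (§2), i.e. `‖wQ X‖ ≤ (Π_{j∈H(X)} D_jσ_j)·θ^{β′|X∖H(X)|}`, where for the observables NOT near the boundary the
small factor beats the large one, `D_jσ_j ≤ B_j` (§3; *"at least if X_{r′} is not at the boundary"*), while near the boundary only `σ_j ≤ 1` is used:
`‖G_k(X′)‖ ≤ [e^{2a₀#T}·N_D(X′)·Π_{j∈obsIn X′, ¬bdry j} B_j] · θ^{β″·#(T∖slot cubes)} · Π_{j∈obsIn X′, bdry j} D_j` — print's `c(F(X))` (it depends
on the observables `F` in `X`), print's power of the vertex factor, print's product over the observables near the boundary.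
[cite: BalabanImbrieJaffe1988, (5.14.5) p.312] -/
theorem norm_Gk_le_boundaryForm (hR : ∀ x y, adj x y → adj y x) (hΔ : ∀ x, (nbr x).card ≤ Δ) (hnbr : ∀ x y, adj x y → y ∈ nbr x)
    {θ β' β'' a₀ : ℝ} (hθ0 : 0 < θ) (hθ1 : θ ≤ 1) (hβ'' : 0 ≤ β'') (hβ : β'' ≤ β') (ha₀ : a₀ ≤ 1 / 2)
    (hsmall : 2 * ((Δ : ℝ) + 1) ^ 2 * θ ^ (β' - β'') * Real.exp a₀ ≤ a₀)
    {w : Finset ι → ℂ} (hz0 : ∀ X ∈ polysOf W, ¬ IsRConnected adj X → w X = 0) (hz : ∀ X ∈ polysOf W, ‖w X‖ ≤ θ ^ (β' * (X.card : ℝ)))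
    {wQ : Finset ι → ℂ} (bdry : S → Prop) [DecidablePred bdry] {D σ B : S → ℝ} (hD : ∀ j, 0 ≤ D j) (hσ0 : ∀ j, 0 ≤ σ j)
    (hσ1 : ∀ j, σ j ≤ 1) (hbeat : ∀ j, ¬ bdry j → D j * σ j ≤ B j)
    (hobs : ∀ X ∈ obsPolys W loc K,
      ‖wQ X‖ ≤ (∏ j ∈ slotsIn loc K X, D j * σ j) * θ ^ (β' * ((X \ (slotsIn loc K X).image loc).card : ℝ)))
    (X' : Finset (ι ⊕ (Finset ι × Finset ι))) :
    ‖Gk (cvsupp adj W) (cvsupp adj W) (slotsIn loc K) (locv1 loc) K (obsPolys W loc K) wQ (Ov (cvsupp adj W)) w (polysOf W) X'‖ ≤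
      (Real.exp (2 * a₀ * (X'.filter fun v => v.isLeft).card) *
          (((obsPolys W loc K).powerset.filter fun D => (∀ X ∈ D, ∀ X₂ ∈ D, X ≠ X₂ → Disjoint (cvsupp adj W X) (cvsupp adj W X₂)) ∧
              D.biUnion (slotsIn loc K) = obsIn (locv1 loc) K X' ∧ dsupp (cvsupp adj W) D ⊆ X').card : ℝ) *
          ∏ j ∈ (obsIn (locv1 loc) K X').filter (fun j => ¬ bdry j), B j) *
        θ ^ (β'' * (((X'.filter fun v => v.isLeft) \ K.image (locv loc)).card : ℝ)) *
        ∏ j ∈ (obsIn (locv1 loc) K X').filter (fun j => bdry j), D j := by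
  set c : S → ℝ := fun j => if bdry j then D j else B j with hc
  have hle : ∀ j, D j * σ j ≤ c j := fun j => by
    by_cases h : bdry j
    · simp only [hc, h, if_true]; exact mul_le_of_le_one_right (hD j) (hσ1 j)
    · simp only [hc, h, if_false]; exact hbeat j h
  have hc0 : ∀ j, 0 ≤ c j := fun j => (mul_nonneg (hD j) (hσ0 j)).trans (hle j)
  have hobs' : ∀ X ∈ obsPolys W loc K,
      ‖wQ X‖ ≤ (∏ j ∈ slotsIn loc K X, c j) * θ ^ (β' * ((X \ (slotsIn loc K X).image loc).card : ℝ)) := fun X hX =>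
    (hobs X hX).trans (mul_le_mul_of_nonneg_right
      (prod_le_prod (fun j _ => mul_nonneg (hD j) (hσ0 j)) fun j _ => hle j) (Real.rpow_nonneg hθ0.le _))
  have h := norm_Gk_le_printed (loc := loc) (K := K) hR hΔ hnbr hθ0 hθ1 hβ'' hβ ha₀ hsmall hz0 hz hc0 hobs' X'
  have hsplit : ∏ j ∈ obsIn (locv1 loc) K X', c j =
      (∏ j ∈ (obsIn (locv1 loc) K X').filter (fun j => bdry j), D j) *
        ∏ j ∈ (obsIn (locv1 loc) K X').filter (fun j => ¬ bdry j), B j := prod_ite _ _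
  rw [hsplit] at h
  refine h.trans (le_of_eq ?_)
  ring

end Main

/-! ### As instances of the typed leaf `Ineq312` (universe-0 carriers, as in gen 12) -/

section Leaf

variable {ι : Type} [DecidableEq ι] [Fintype ι] {S : Type} [DecidableEq S] {adj : ι → ι → Prop} [DecidableRel adj] {nbr : ι → Finset ι}
  {Δ : ℕ} {W : Finset ι} {loc : S → ι} {K : Finset S}

/-- **THE LEAF `Ineq312` IN THE PRINTED CURRENCY**: `Ineq312 (cubeSys (ι ⊕ (Finset ι × Finset ι))) Gk cF obsProd nfree θ β″` with
`obsProd X′ := Π_{j∈obsIn X′, bdry j} D_j` (*"Π_{X_{σ₁}⊂X: dist(X_{σ₁},Λ^{(k)c}_{12}) < r(e_k)} [c(L^kε)^{−m(c)}e^{−m′(c)}]"*),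
`cF X′ := e^{2a₀#T(X′)}·N_D(X′)·Π_{j∈obsIn X′, ¬bdry j} B_j` (*"c(F(X))"*), `nfree X′ := #(T(X′) ∖ slot cubes)` (*"|X∖∪X_c|"*), under the
hypotheses of `norm_Gk_le_boundaryForm`. [cite: BalabanImbrieJaffe1988, (5.14.5) p.312] -/
theorem ineq312_boundaryForm (hR : ∀ x y, adj x y → adj y x) (hΔ : ∀ x, (nbr x).card ≤ Δ) (hnbr : ∀ x y, adj x y → y ∈ nbr x)
    {θ β' β'' a₀ : ℝ} (hθ0 : 0 < θ) (hθ1 : θ ≤ 1) (hβ'' : 0 ≤ β'') (hβ : β'' ≤ β') (ha₀ : a₀ ≤ 1 / 2)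
    (hsmall : 2 * ((Δ : ℝ) + 1) ^ 2 * θ ^ (β' - β'') * Real.exp a₀ ≤ a₀)
    {w : Finset ι → ℂ} (hz0 : ∀ X ∈ polysOf W, ¬ IsRConnected adj X → w X = 0) (hz : ∀ X ∈ polysOf W, ‖w X‖ ≤ θ ^ (β' * (X.card : ℝ)))
    {wQ : Finset ι → ℂ} (bdry : S → Prop) [DecidablePred bdry] {D σ B : S → ℝ} (hD : ∀ j, 0 ≤ D j) (hσ0 : ∀ j, 0 ≤ σ j)
    (hσ1 : ∀ j, σ j ≤ 1) (hbeat : ∀ j, ¬ bdry j → D j * σ j ≤ B j)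
    (hobs : ∀ X ∈ obsPolys W loc K,
      ‖wQ X‖ ≤ (∏ j ∈ slotsIn loc K X, D j * σ j) * θ ^ (β' * ((X \ (slotsIn loc K X).image loc).card : ℝ))) :
    BIJ88Sect5StatementsPart4.Ineq312 (cubeSys (ι ⊕ (Finset ι × Finset ι)))
      (fun X' : Finset (ι ⊕ (Finset ι × Finset ι)) =>
        ‖Gk (cvsupp adj W) (cvsupp adj W) (slotsIn loc K) (locv1 loc) K (obsPolys W loc K) wQ (Ov (cvsupp adj W)) w (polysOf W) X'‖)
      (fun X' : Finset (ι ⊕ (Finset ι × Finset ι)) => Real.exp (2 * a₀ * (X'.filter fun v => v.isLeft).card) *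
        (((obsPolys W loc K).powerset.filter fun D => (∀ X ∈ D, ∀ X₂ ∈ D, X ≠ X₂ → Disjoint (cvsupp adj W X) (cvsupp adj W X₂)) ∧
            D.biUnion (slotsIn loc K) = obsIn (locv1 loc) K X' ∧ dsupp (cvsupp adj W) D ⊆ X').card : ℝ) *
        ∏ j ∈ (obsIn (locv1 loc) K X').filter (fun j => ¬ bdry j), B j)
      (fun X' : Finset (ι ⊕ (Finset ι × Finset ι)) => ∏ j ∈ (obsIn (locv1 loc) K X').filter (fun j => bdry j), D j)
      (fun X' : Finset (ι ⊕ (Finset ι × Finset ι)) => ((X'.filter fun v => v.isLeft) \ K.image (locv loc)).card) θ β'' := by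
  intro X'
  rw [abs_norm]
  exact norm_Gk_le_boundaryForm hR hΔ hnbr hθ0 hθ1 hβ'' hβ ha₀ hsmall hz0 hz bdry hD hσ0 hσ1 hbeat hobs X'

/-- **… WITH THE BEAT DISCHARGED IN THE VERTEX CASE (§3)**: the vertex factor `θ = E·s^{1/4−α}` (`s = L^kε/ε₀ ∈ (0,1]`, `0 < θ ≤ 1`), the
printed large factors `D_j = C_j·(L^kε)^{−m_j^c} = C_j·(sε₀)^{−m_j^c}` (`C_j ≥ 0`), and for each located observable `j` NOT near the boundary an
integration-by-parts depth `m_j` with `(m_j + 1)(1/4 − α) ≥ m_j^c` (*"By performing sufficiently many integrations by parts"*), the small factor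
`σ_j = θ^{m_j+1}` of its `m_j + 1` differentiated interactions: observable activities with `‖wQ X‖ ≤ (Π_{j∈H(X)} D_j θ^{m_j+1})·θ^{β′|X∖H(X)|}`
give the leaf `Ineq312` with `obsProd X′ = Π_{j∈obsIn X′, bdry j} C_j(L^kε)^{−m_j^c}` and
`cF X′ = e^{2a₀#T}·N_D(X′)·Π_{j∈obsIn X′, ¬bdry j} C_jE^{m_j+1}ε₀^{−m_j^c}` — k-UNIFORM constants in front, large factors only near the boundary.
[cite: BalabanImbrieJaffe1988, (5.14.5) p.312] -/
theorem ineq312_printedCurrency (hR : ∀ x y, adj x y → adj y x) (hΔ : ∀ x, (nbr x).card ≤ Δ) (hnbr : ∀ x y, adj x y → y ∈ nbr x)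
    {E s ε₀ α β' β'' a₀ : ℝ} (hE : 0 ≤ E) (hs0 : 0 < s) (hs1 : s ≤ 1) (hε₀ : 0 < ε₀) (hθ0 : 0 < E * s ^ (1 / 4 - α))
    (hθ1 : E * s ^ (1 / 4 - α) ≤ 1) (hβ'' : 0 ≤ β'') (hβ : β'' ≤ β') (ha₀ : a₀ ≤ 1 / 2)
    (hsmall : 2 * ((Δ : ℝ) + 1) ^ 2 * (E * s ^ (1 / 4 - α)) ^ (β' - β'') * Real.exp a₀ ≤ a₀)
    {w : Finset ι → ℂ} (hz0 : ∀ X ∈ polysOf W, ¬ IsRConnected adj X → w X = 0)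
    (hz : ∀ X ∈ polysOf W, ‖w X‖ ≤ (E * s ^ (1 / 4 - α)) ^ (β' * (X.card : ℝ)))
    {wQ : Finset ι → ℂ} (bdry : S → Prop) [DecidablePred bdry] {C mc : S → ℝ} {mV : S → ℕ} (hC : ∀ j, 0 ≤ C j)
    (hdepth : ∀ j, ¬ bdry j → mc j ≤ ((mV j : ℝ) + 1) * (1 / 4 - α))
    (hobs : ∀ X ∈ obsPolys W loc K, ‖wQ X‖ ≤ (∏ j ∈ slotsIn loc K X, C j * (s * ε₀) ^ (-mc j) * (E * s ^ (1 / 4 - α)) ^ (mV j + 1)) *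
      (E * s ^ (1 / 4 - α)) ^ (β' * ((X \ (slotsIn loc K X).image loc).card : ℝ))) :
    BIJ88Sect5StatementsPart4.Ineq312 (cubeSys (ι ⊕ (Finset ι × Finset ι)))
      (fun X' : Finset (ι ⊕ (Finset ι × Finset ι)) =>
        ‖Gk (cvsupp adj W) (cvsupp adj W) (slotsIn loc K) (locv1 loc) K (obsPolys W loc K) wQ (Ov (cvsupp adj W)) w (polysOf W) X'‖)
      (fun X' : Finset (ι ⊕ (Finset ι × Finset ι)) => Real.exp (2 * a₀ * (X'.filter fun v => v.isLeft).card) *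
        (((obsPolys W loc K).powerset.filter fun D => (∀ X ∈ D, ∀ X₂ ∈ D, X ≠ X₂ → Disjoint (cvsupp adj W X) (cvsupp adj W X₂)) ∧
            D.biUnion (slotsIn loc K) = obsIn (locv1 loc) K X' ∧ dsupp (cvsupp adj W) D ⊆ X').card : ℝ) *
        ∏ j ∈ (obsIn (locv1 loc) K X').filter (fun j => ¬ bdry j), C j * E ^ (mV j + 1) * ε₀ ^ (-mc j))
      (fun X' : Finset (ι ⊕ (Finset ι × Finset ι)) => ∏ j ∈ (obsIn (locv1 loc) K X').filter (fun j => bdry j), C j * (s * ε₀) ^ (-mc j))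
      (fun X' : Finset (ι ⊕ (Finset ι × Finset ι)) => ((X'.filter fun v => v.isLeft) \ K.image (locv loc)).card)
      (E * s ^ (1 / 4 - α)) β'' := by
  refine ineq312_boundaryForm hR hΔ hnbr hθ0 hθ1 hβ'' hβ ha₀ hsmall hz0 hz bdry (D := fun j => C j * (s * ε₀) ^ (-mc j))
    (σ := fun j => (E * s ^ (1 / 4 - α)) ^ (mV j + 1)) (B := fun j => C j * E ^ (mV j + 1) * ε₀ ^ (-mc j))
    (fun j => mul_nonneg (hC j) (Real.rpow_nonneg (mul_nonneg hs0.le hε₀.le) _)) (fun j => pow_nonneg hθ0.le _)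
    (fun j => pow_le_one₀ hθ0.le hθ1) (fun j hj => ?_) hobs
  show C j * (s * ε₀) ^ (-mc j) * (E * s ^ (1 / 4 - α)) ^ (mV j + 1) ≤ C j * E ^ (mV j + 1) * ε₀ ^ (-mc j)
  rw [mul_comm]
  exact vertex_pow_mul_large_le hE hs0 hs1 hε₀ (hC j) (hdepth j hj)

end Leaf

/-! ## §5 (v1.1, append-only) The estimate with the small factors READ OFF the remainder components of §1–§2

The abstract completeness small factors `σ_j` of §4 instantiated by the `smallFactor` of a remainder component attached to each located observable
not near the boundary (§1–§2), the beat supplied by `smallFactor_mul_large_le` (§3): the four sections in one statement. -/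

section Components

variable {ι : Type} [DecidableEq ι] [Fintype ι] {S : Type} [DecidableEq S] {adj : ι → ι → Prop} [DecidableRel adj] {nbr : ι → Finset ι}
  {Δ : ℕ} {W : Finset ι} {loc : S → ι} {K : Finset S}

/-- **`Ineq312` FROM THE REMAINDER COMPONENTS**: each located observable `j` sits in a component `κ j` of the integration-by-parts expansion
(§1); its activity carries the large factor `D_j` times the component's small factor `smallFactor θ_χ θ_RW θ_V (κ j)` (§2); away from the
boundary the component is a REMAINDER component (*"at least if X_{r′} is not at the boundary"*) and each of the three small factors beats `D_j`
(§3: `chi_mul_large_le`, `rw_mul_large_le`, `vertex_pow_mul_large_le` supply `θ_χD_j, θ_RWD_j, θ_V^{m+1}D_j ≤ B_j`). Then the leaf `Ineq312` holds in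
the printed currency of `ineq312_boundaryForm`. [cite: BalabanImbrieJaffe1988, (5.14.5) p.312] -/
theorem ineq312_of_remainderComponents (hR : ∀ x y, adj x y → adj y x) (hΔ : ∀ x, (nbr x).card ≤ Δ)
    (hnbr : ∀ x y, adj x y → y ∈ nbr x) {θ β' β'' a₀ : ℝ} (hθ0 : 0 < θ) (hθ1 : θ ≤ 1) (hβ'' : 0 ≤ β'') (hβ : β'' ≤ β')
    (ha₀ : a₀ ≤ 1 / 2) (hsmall : 2 * ((Δ : ℝ) + 1) ^ 2 * θ ^ (β' - β'') * Real.exp a₀ ≤ a₀)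
    {w : Finset ι → ℂ} (hz0 : ∀ X ∈ polysOf W, ¬ IsRConnected adj X → w X = 0) (hz : ∀ X ∈ polysOf W, ‖w X‖ ≤ θ ^ (β' * (X.card : ℝ)))
    {wQ : Finset ι → ℂ} (bdry : S → Prop) [DecidablePred bdry] {D B : S → ℝ} (hD : ∀ j, 0 ≤ D j)
    {θχ θRW θV : ℝ} (h1 : 0 ≤ θχ) (h1' : θχ ≤ 1) (h2 : 0 ≤ θRW) (h2' : θRW ≤ 1) (h3 : 0 ≤ θV) (h3' : θV ≤ 1)
    {m : ℕ} (κ : S → IbpComponent) (hrem : ∀ j, ¬ bdry j → IbpComponent.IsRemainder m (κ j))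
    (hbχ : ∀ j, ¬ bdry j → θχ * D j ≤ B j) (hbRW : ∀ j, ¬ bdry j → θRW * D j ≤ B j) (hbV : ∀ j, ¬ bdry j → θV ^ (m + 1) * D j ≤ B j)
    (hobs : ∀ X ∈ obsPolys W loc K, ‖wQ X‖ ≤ (∏ j ∈ slotsIn loc K X, D j * IbpComponent.smallFactor θχ θRW θV (κ j)) *
      θ ^ (β' * ((X \ (slotsIn loc K X).image loc).card : ℝ))) :
    BIJ88Sect5StatementsPart4.Ineq312 (cubeSys (ι ⊕ (Finset ι × Finset ι)))
      (fun X' : Finset (ι ⊕ (Finset ι × Finset ι)) =>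
        ‖Gk (cvsupp adj W) (cvsupp adj W) (slotsIn loc K) (locv1 loc) K (obsPolys W loc K) wQ (Ov (cvsupp adj W)) w (polysOf W) X'‖)
      (fun X' : Finset (ι ⊕ (Finset ι × Finset ι)) => Real.exp (2 * a₀ * (X'.filter fun v => v.isLeft).card) *
        (((obsPolys W loc K).powerset.filter fun D => (∀ X ∈ D, ∀ X₂ ∈ D, X ≠ X₂ → Disjoint (cvsupp adj W X) (cvsupp adj W X₂)) ∧
            D.biUnion (slotsIn loc K) = obsIn (locv1 loc) K X' ∧ dsupp (cvsupp adj W) D ⊆ X').card : ℝ) *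
        ∏ j ∈ (obsIn (locv1 loc) K X').filter (fun j => ¬ bdry j), B j)
      (fun X' : Finset (ι ⊕ (Finset ι × Finset ι)) => ∏ j ∈ (obsIn (locv1 loc) K X').filter (fun j => bdry j), D j)
      (fun X' : Finset (ι ⊕ (Finset ι × Finset ι)) => ((X'.filter fun v => v.isLeft) \ K.image (locv loc)).card) θ β'' :=
  ineq312_boundaryForm hR hΔ hnbr hθ0 hθ1 hβ'' hβ ha₀ hsmall hz0 hz bdry (σ := fun j => IbpComponent.smallFactor θχ θRW θV (κ j)) hD
    (fun j => IbpComponent.smallFactor_nonneg h1 h2 h3 (κ j)) (fun j => IbpComponent.smallFactor_le_one h1 h1' h2 h2' h3 h3' (κ j))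
    (fun j hj => by
      rw [mul_comm]
      exact smallFactor_mul_large_le h1 h1' h2 h2' h3 h3' (hD j) (hrem j hj) (hbχ j hj) (hbRW j hj) (hbV j hj))
    hobs

end Components

end Literature.MathematicalPhysics.QuantumFieldTheory.BalabanImbrieJaffe1984to88.BIJ88ObservableExtraction312

end
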